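import Literature.MathematicalPhysics.QuantumFieldTheory.Balaban1983to89.Node00.OpsYOps312OfRecord
import Literature.MathematicalPhysics.QuantumFieldTheory.Balaban1983to89.Node00.OpsYRecordV11

/-!
# `Balaban1983to89.Node00.OpsYOps312OfRecordPar` — T. Bałaban, *Propagators for lattice gauge theories in a background field*, Commun. Math. Phys. **99**
# (1985) 389–434 [Balaban1985BackgroundPropagators], Sect. D, Theorems 3.12–3.13 pp. 419–426: THE SECT.-D OPERATOR RECORD `𝔬12` OF STAGE 3′(Y), PARAMETRIC
# ONCE in the letters of record `𝔏`, the averaging pair `(𝔮, 𝔮⋆)` and the site transporter `parS` — `ops312YOfRecordPar`, its twenty-two faces, `pins312Par_of_eq`;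
# today's record as the instance by `rfl`; the KNIT instance `ops312YOfRecordK` (letters `lettersYOfRecordV11K`, pair `(qKnitOfRecord, qsKnitOfRecord)`, transporter
# `parKnitY`) with `pins312K_of_eq` — Node 00 instance layer (def-Y), CASCADE-K step K0

statement-level skeleton of published theorems with citation tags; proofs where landed; nothing here is a claim about the Yang–Mills mass gap

THE PRINT.  Sect. D (pp. 419–426) works with a fixed list of operators depending on the background configuration `U` — `G₀ = (Δ + DRD* + Q*aQ)⁻¹` (p. 421),
`Δ_a = G₀⁻¹` (Thm 3.11 p. 416, (3.26) p. 395), `Δ′_π` ((3.120)–(3.121) p. 420), `Δ⁽²⁾_π` ((3.135) p. 422), `G̃ = (Δ_π + DRD* + Q*aQ)⁻¹` ((3.122) p. 420), `G₁`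
((3.128) p. 421), `𝔊` ((3.153) p. 426), `∇_U ∕ ∇*_U` ((3.42) p. 397), the averaging operator `Q` and its adjoint `Q*` ((3.13) p. 393; in Sect. D the `Q` is the
averaging (3.115) p. 418 of the renormalization transformation, *«Q is the linearization of the averaging operation (52)–(53) of [5]»*), `C = (QG̃Q*)⁻¹ ∕ C₁ =
(QG₁Q*)⁻¹` ((3.123) p. 420, (3.132) p. 422), `H ∕ H₁` ((3.126) p. 420, (3.129) p. 421), and `D ∕ D* ∕ R` ((3.6)–(3.8) pp. 391–392, (3.25) p. 394, (3.124) p. 420).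
In the N06 certificate these are the twenty-two fields of n06-d's parameter record `B9Thm312Whole.Ops`, pinned to def-Y's letters by the twenty-two hypotheses
`hblk12 … hRco12` (`Node00.OpsYOps312OfRecord`, def-Y g28).

WHY THIS FILE (pub-ymgap fleet bus 2026-08-30: director-ym g18 №383 «GO CASCADE-K … K0 = def-Y: the carriers ∕ records with the transporter as PARAMETER, parametric
ONCE not twinned, additive editions only, today's objects = the instance by `rfl`»; dag-n06-d g24 K0 WANT-LIST item W3 «`ops312YOfRecord` :88 + `pins312_of_eq` :291
⟶ `ops312YOfRecordPar … (𝔏) (𝔮 𝔮s)` or the knit instance `ops312YOfRecordK` over `lettersYOfRecordV11K` + `QcoKHq (qKnitOfRecord …) ∕ QscoKHq (qsKnitOfRecord …)`,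
with `pins312_of_eq` in the same row order»).  The knit certificate «K» (CASCADE-K step K3) reads the Sect.-D operators at the KNIT letters of record
(`Node00.OpsYRecordV11.lettersYOfRecordV11K`: the nine `Q`-dependent letters rebuilt over the knit averaging pair `(qKnitOfRecord, qsKnitOfRecord)` of
`Node00.OpsYQLetter` and print's knit site transporter `parKnitY` of [Balaban1985Averaging] Prop. 2), where today's record `ops312YOfRecord` hard-wires
`lettersYOfRecordV4P`, the straight-contour pair `(QY parBY, QsY parBY)` inside `S0coK ∕ QcoKH ∕ QscoKH ∕ CcoK ∕ C1coK`, and `parSymY`.  This file makes those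
three data PARAMETERS, once.

WHAT THIS FILE DOES (definitions by field assignment + `rfl` faces; additive — `Node00.OpsYOps312OfRecord`, `Node00.OpsYSectDCoords` and the N06 seats' files are
imported or untouched, never edited):
* §0 the five `𝔮`-GENERIC COORDINATE MODELS `S0coKq ∕ QcoKHq ∕ QscoKHq ∕ CcoKq ∕ C1coKq` (the models `S0coK ∕ QcoKH ∕ QscoKH ∕ CcoK ∕ C1coK` of
  `Node00.OpsYSectDCoords` §5 with `Δ_a ∕ Q ∕ Q* ∕ (QG̃Q*)⁻¹ ∕ (QG₁Q*)⁻¹` read through `Node00.OpsYSectDQ`'s `deltaAQY ∕ 𝔮 ∕ 𝔮⋆ ∕ QGQinvQY ∕ QG1QinvQY` over a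
  generic pair), and their `rfl` faces `…_QY` onto the §5 models at the straight-contour pair `(QY parB, QsY parB)`;
* §1 ★★ `ops312YOfRecordPar N θ M⋆ 𝔯 R₁ R₂ bI 𝔏 𝔮 𝔮⋆ parS x` — `ops312YOfRecord` verbatim with `(lettersYOfRecordV4P … x) ↦ 𝔏 x`, `parSymY ↦ parS` (site
  operator `GpPhysY x.toKIdx (parS x.toKIdx)`), and the five `Q`-dependent fields through the §0 models at `(𝔮 x.toKIdx, 𝔮⋆ x.toKIdx)`; the member `x` is the
  LAST binder, so `ops312YOfRecordPar N θ M⋆ 𝔯 R₁ R₂ bI 𝔏 𝔮 𝔮⋆ parS` has the type of the certificate's binder `𝔬12`;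
* §2 the twenty-two field faces (`rfl` by projection);
* §3 ★★ TODAY'S RECORD IS THE INSTANCE: `ops312YOfRecord_eq_par : ops312YOfRecord N θ M⋆ 𝔯 R₁ R₂ bI = ops312YOfRecordPar … (lettersYOfRecordV4P N θ M⋆ 𝔯)
  (qYOfRecord N θ) (qsYOfRecord N θ) parSymY` (`rfl`); ★★★ THE KNIT INSTANCE `ops312YOfRecordK N θ M⋆ 𝔯 R₁ R₂ bI x := ops312YOfRecordPar … (lettersYOfRecordV11K N θ
  M⋆ 𝔯) (qKnitOfRecord N θ) (qsKnitOfRecord N θ) parKnitY x` and `ops312YOfRecordK_eq` (`rfl`);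
* §4 ★★★ `pins312Par_of_eq : 𝔬12 = ops312YOfRecordPar … → ⟨hblk12, …, hRco12⟩` (the twenty-two pins in the order of `pins312_of_eq`, read over the parameters)
  and `pins312K_of_eq : 𝔬12 = ops312YOfRecordK … → ⟨…⟩` (the same at the knit instance, letters `lettersYOfRecordV11K`, pair `(qKnitOfRecord, qsKnitOfRecord)`,
  transporter `parKnitY`).

HONEST SCOPE.  Definitional packaging and `rfl` transport only: no inverse is constructed beyond what the readers already are (`Ring.inverse`, total), and no
identity, inequality, expansion or positivity statement of the paper is proved or asserted (Theorem 3.12's conclusions stay the certificate's letters and rows;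
the `Identities` hypotheses of the knit stay displayed where `Node00.OpsYSectDCoords` §6–§7, `Node00.OpsYIds3152ReductionQ` and the located gap O5 leave them; at
the knit pair the (3.115)∕(3.124) rows are supplied by `Node00.OpsYRecordV11Reg335 ∕ …Thresh` under their displayed regime and numerics, not here).  The
regularity classes `R₁ R₂`, the block map `bI`, the residual family `𝔯` and — in §1–§2, §4 — the letters `𝔏`, the pair `(𝔮, 𝔮⋆)` and the transporter `parS`
stay binders.  Nothing landed is modified; count-neutral; N06 is NOT discharged; one finite lattice programme at fixed ε; NOT continuum, NOT ℝ⁴, NOT OS, NOT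
the mass gap, NOT Clay.  Filed by the pub-ymgap def-Y owner lineage (`pub-ymgap-node00-def-Y` g32), cell `pub-ymgap` (D-0062), node N06 [B9] at NODE 00's
instance, CASCADE-K step K0, 2026-08-30.
-/

noncomputable section

namespace Literature.MathematicalPhysics.QuantumFieldTheory.Balaban1983to89.Node00.OpsYOps312OfRecordPar

open Node00
open B6KLevelCensusIndexV1 (KIdx)
open B9PinMembersKLevelV1 (MemberY geo9Y)
open B9BackgroundsKLevelV1R (RegFamY bg9YR)
open B7Prop2SpecialUnitary (specialUnitaryUnits)
open B9CoReadingCoordsTranspose (TrIdx trBasis)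
open B9CoReadingCoords (XBK blkBK GcoK DcoK DscoK coordOpK)
open B9CoReadingCoordsS (XSK blkSK sIK)
open B9CoReadingCoordsH (XHK blkHK HcoK coordOpKH)
open B9Thm39ReadingCoords (cR39)
open B9B8AveragingJunction (parKnitY)
open Literature.MathematicalPhysics.QuantumFieldTheory.Balaban1983to89.Node00.OpsYSectDCoords
  (S0coK TpicoK T2coK QcoKH QscoKH CcoK C1coK DvcoKH DvscoKH RcoK)
open Literature.MathematicalPhysics.QuantumFieldTheory.Balaban1983to89.Node00.OpsYOps312OfRecord (ops312YOfRecord)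
open Literature.MathematicalPhysics.QuantumFieldTheory.Balaban1983to89.Node00.OpsYQLetter
  (QLetterY QsLetterY QFamY QsFamY qYOfRecord qsYOfRecord qKnitOfRecord qsKnitOfRecord)
open scoped Matrix.Norms.L2Operator

/-! ## §0 The five `𝔮`-generic coordinate models of the `Q`-dependent `Ops` fields (`Δ_a ∕ Q ∕ Q* ∕ C ∕ C₁`) and their `rfl` faces at the straight-contour pair -/

section CoordsQ

variable {𝔸 : Type} [NormedRing 𝔸] [NormedAlgebra ℂ 𝔸] [CompleteSpace 𝔸] [FiniteDimensional ℝ 𝔸] {κ : Type} [Fintype κ]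
variable {d ℓ : ℕ} {hd : 1 ≤ d + 1} {hL : Odd (ℓ + 1) ∧ 1 < ℓ + 1} {b₀ b₁ : ℝ} (i : KIdx d ℓ hd hL b₀ b₁)
  (b : Module.Basis κ ℝ 𝔸) (B : B9.Backgrounds) (cfg : B.Cfg → CfgY 𝔸 i)
  (𝔮 : QLetterY 𝔸 i) (𝔮s : QsLetterY 𝔸 i) (parS : SiteParY 𝔸 i) (parB : BondParY 𝔸 i) (Gp : SiteOpY 𝔸 i) (Δ2 : BondOpY 𝔸 i)

/-- the model of `Δ_a[𝔮](U) = Δ + D R D* + 𝔮⋆ a 𝔮` (3.26) = print's `G₀⁻¹` (p.421) over a generic averaging pair, scaled `c⁻¹` (the inverse scaling of `GcoK`):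
`S0coK` with `deltaAY` read as `deltaAQY i 𝔮 𝔮⋆`. [cite: Balaban1985BackgroundPropagators, (3.26) p.395, p.421 («G₀»), (3.115) p.418] -/
def S0coKq (U₁ : B.Cfg) : (XBK κ i → ℝ) →ₗ[ℝ] (XBK κ i → ℝ) :=
  (cR39 b)⁻¹ • coordOpK b (fun _ : Fin (d + 1) => (deltaAQY i 𝔮 𝔮s parS Gp (cfg U₁)).restrictScalars ℝ)

/-- the model of a generic averaging letter `𝔮(U)` (fine bonds → coarse bonds), scaled `c⁻¹`: `QcoKH` with `QY i parB` read as `𝔮`.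
[cite: Balaban1985BackgroundPropagators, (3.13) p.393, (3.115) p.418] -/
def QcoKHq (U₁ : B.Cfg) : (XBK κ i → ℝ) →ₗ[ℝ] (XHK κ i → ℝ) :=
  (cR39 b)⁻¹ • coordOpKH b (fun _ : Fin (d + 1) => (𝔮 (cfg U₁)).restrictScalars ℝ)

/-- the model of a generic adjoint averaging letter `𝔮⋆(U)`, scaled `c⁻¹`: `QscoKH` with `QsY i parB` read as `𝔮⋆`.
[cite: Balaban1985BackgroundPropagators, (3.13) p.393 (Q* the adjoint of Q), (3.115) p.418] -/
def QscoKHq (U₁ : B.Cfg) : (XHK κ i → ℝ) →ₗ[ℝ] (XBK κ i → ℝ) :=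
  (cR39 b)⁻¹ • coordOpKH b (fun _ : Fin (d + 1) => (𝔮s (cfg U₁)).restrictScalars ℝ)

/-- the model of `C = (𝔮G̃𝔮⋆)⁻¹(U)` (3.123)∕(3.132) over a generic pair, scaled `c`: `CcoK` with `QGQinvY` read as `QGQinvQY i 𝔮 𝔮⋆`.
[cite: Balaban1985BackgroundPropagators, (3.123) p.420, (3.132) p.422] -/
def CcoKq (U₁ : B.Cfg) : (XHK κ i → ℝ) →ₗ[ℝ] (XHK κ i → ℝ) :=
  cR39 b • coordOpK b (fun _ : Fin (d + 1) => (QGQinvQY i 𝔮 𝔮s parS Gp (cfg U₁)).restrictScalars ℝ)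

/-- the model of `C₁ = (𝔮G₁𝔮⋆)⁻¹(U)` (3.132) over a generic pair, scaled `c`: `C1coK` with `QG1QinvY` read as `QG1QinvQY i 𝔮 𝔮⋆`.
[cite: Balaban1985BackgroundPropagators, (3.132) p.422, (3.128) p.421] -/
def C1coKq (U₁ : B.Cfg) : (XHK κ i → ℝ) →ₗ[ℝ] (XHK κ i → ℝ) :=
  cR39 b • coordOpK b (fun _ : Fin (d + 1) => (QG1QinvQY i 𝔮 𝔮s parS Gp Δ2 (cfg U₁)).restrictScalars ℝ)

/-- `S0coKq` at the straight-contour pair `(QY parB, QsY parB)` IS `S0coK` (definitionally). [cite: Balaban1985BackgroundPropagators, (3.26) p.395, (3.13) p.393] -/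
theorem S0coKq_QY : S0coKq i b B cfg (QY i parB) (QsY i parB) parS Gp = S0coK i b B cfg parS parB Gp := rfl

/-- `QcoKHq` at `QY parB` IS `QcoKH`. [cite: Balaban1985BackgroundPropagators, (3.13) p.393] -/
theorem QcoKHq_QY : QcoKHq i b B cfg (QY i parB) = QcoKH i b B cfg parB := rfl

/-- `QscoKHq` at `QsY parB` IS `QscoKH`. [cite: Balaban1985BackgroundPropagators, (3.13) p.393] -/
theorem QscoKHq_QY : QscoKHq i b B cfg (QsY i parB) = QscoKH i b B cfg parB := rfl

/-- `CcoKq` at the straight-contour pair IS `CcoK`. [cite: Balaban1985BackgroundPropagators, (3.123) p.420, (3.132) p.422] -/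
theorem CcoKq_QY : CcoKq i b B cfg (QY i parB) (QsY i parB) parS Gp = CcoK i b B cfg parS parB Gp := rfl

/-- `C1coKq` at the straight-contour pair IS `C1coK`. [cite: Balaban1985BackgroundPropagators, (3.132) p.422] -/
theorem C1coKq_QY : C1coKq i b B cfg (QY i parB) (QsY i parB) parS Gp Δ2 = C1coK i b B cfg parS parB Gp Δ2 := rfl

end CoordsQ

/-! ## §1 The Sect.-D operator record of Stage 3′(Y), PARAMETRIC in `(𝔏, 𝔮, 𝔮⋆, parS)`, in the class-parametric typing -/

section Record

variable (N : ℕ) (θ : Stage3Params) (Mstar : ℕ) (𝔯 : ResY N θ Mstar)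
  (R₁ R₂ : RegFamY θ.d₆ θ.ℓ₆ θ.hd' θ.hL' θ.b₀ θ.b₁ Mstar (Matrix (Fin N) (Fin N) ℂ))
  (bI : ∀ x : MemberY θ.d₆ θ.ℓ₆ θ.hd' θ.hL' θ.b₀ θ.b₁ Mstar, FBondY x.toKIdx → IBondY x.toKIdx)
  (𝔏 : LettersY N θ Mstar) (𝔮 : QFamY N θ) (𝔮s : QsFamY N θ)
  (parS : ∀ i : KIdx θ.d₆ θ.ℓ₆ θ.hd' θ.hL' θ.b₀ θ.b₁, SiteParY (Matrix (Fin N) (Fin N) ℂ) i)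

/-- ★★ **THE SECT.-D OPERATOR RECORD OF STAGE 3′(Y), PARAMETRIC IN THE LETTERS AND THE AVERAGING PAIR** at the member `x`, over the class-parametric
background carrier `bg9YR … R₁ R₂ x` and n06-d's coordinate carriers `XBK ∕ XBK ∕ XHK ∕ XSK` at the basis index `TrIdx N`: `Node00.OpsYOps312OfRecord.ops312YOfRecord`
VERBATIM except that the letters of record `lettersYOfRecordV4P N θ M⋆ 𝔯` are a PARAMETER `𝔏 : LettersY N θ M⋆` (fields `G₀ ∕ G ∕ G₁ ∕ 𝔊 ∕ H ∕ H₁` = `GcoK ∕ HcoK`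
of `(𝔏 x).GA ∕ GD ∕ G₁ ∕ GG ∕ H ∕ H₁`), the site transporter `parSymY` is a PARAMETER `parS` (fields `Δ_a ∕ Δ′_π ∕ Δ⁽²⁾_π ∕ C ∕ C₁ ∕ R`, site operator
`GpPhysY … (parS …)`), and the straight-contour averaging pair `(QY parBY, QsY parBY)` is a PARAMETER `(𝔮, 𝔮⋆)` (fields `Δ_a ∕ Q ∕ Q* ∕ C ∕ C₁` through the
`𝔮`-generic models `S0coKq ∕ QcoKHq ∕ QscoKHq ∕ CcoKq ∕ C1coKq` of §0); the block maps, `∇_U ∕ ∇*_U ∕ D_U ∕ D*_U` and the residual letter `(𝔯 x).Δ2` as there.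
Today's record is the instance `(lettersYOfRecordV4P …, qYOfRecord, qsYOfRecord, parSymY)` by `rfl` (§3 `ops312YOfRecord_eq_par`); the knit record of the
CASCADE-K certificate is the instance `(lettersYOfRecordV11K …, qKnitOfRecord, qsKnitOfRecord, parKnitY)` (§3 `ops312YOfRecordK`).  A parameter record by
field assignment; nothing of [B9] is asserted.
[cite: Balaban1985BackgroundPropagators, Thm 3.12 p.423, Thm 3.13 p.426, (3.120)–(3.153) pp.419–426, (3.13) p.393, (3.25) p.394, (3.42) p.397, (3.115) p.418] -/
def ops312YOfRecordPar (x : MemberY θ.d₆ θ.ℓ₆ θ.hd' θ.hL' θ.b₀ θ.b₁ Mstar) :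
    B9Thm312Whole.Ops (geo9Y x) (bg9YR (Matrix (Fin N) (Fin N) ℂ) (specialUnitaryUnits (Fin N)) R₁ R₂ x)
      (XBK (TrIdx N) x.toKIdx) (XBK (TrIdx N) x.toKIdx) (XHK (TrIdx N) x.toKIdx) (XSK (TrIdx N) x.toKIdx) where
  blk := blkBK x.toKIdx (bI x)
  blkY := blkBK x.toKIdx (bI x)
  blkZ := blkHK x.toKIdx
  blkW := blkSK x.toKIdx (sIK x.toKIdx (bI x))
  G0 := fun U =>
    GcoK x.toKIdx (trBasis N) (bg9YR (Matrix (Fin N) (Fin N) ℂ) (specialUnitaryUnits (Fin N)) R₁ R₂ x) (fun U => U)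
      (𝔏 x).GA U
  S0 := fun U =>
    S0coKq x.toKIdx (trBasis N) (bg9YR (Matrix (Fin N) (Fin N) ℂ) (specialUnitaryUnits (Fin N)) R₁ R₂ x) (fun U => U) (𝔮 x.toKIdx) (𝔮s x.toKIdx)
      (parS x.toKIdx) (GpPhysY x.toKIdx (parS x.toKIdx)) U
  Tpi := fun U =>
    TpicoK x.toKIdx (trBasis N) (bg9YR (Matrix (Fin N) (Fin N) ℂ) (specialUnitaryUnits (Fin N)) R₁ R₂ x) (fun U => U) (parS x.toKIdx)
      (GpPhysY x.toKIdx (parS x.toKIdx)) U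
  T2 := fun U =>
    T2coK x.toKIdx (trBasis N) (bg9YR (Matrix (Fin N) (Fin N) ℂ) (specialUnitaryUnits (Fin N)) R₁ R₂ x) (fun U => U) (parS x.toKIdx)
      (GpPhysY x.toKIdx (parS x.toKIdx)) (𝔯 x).Δ2 U
  G := fun U =>
    GcoK x.toKIdx (trBasis N) (bg9YR (Matrix (Fin N) (Fin N) ℂ) (specialUnitaryUnits (Fin N)) R₁ R₂ x) (fun U => U)
      (𝔏 x).GD U
  G1 := fun U =>
    GcoK x.toKIdx (trBasis N) (bg9YR (Matrix (Fin N) (Fin N) ℂ) (specialUnitaryUnits (Fin N)) R₁ R₂ x) (fun U => U)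
      (𝔏 x).G₁ U
  GG := fun U =>
    GcoK x.toKIdx (trBasis N) (bg9YR (Matrix (Fin N) (Fin N) ℂ) (specialUnitaryUnits (Fin N)) R₁ R₂ x) (fun U => U)
      (𝔏 x).GG U
  D := fun U => DcoK x.toKIdx (trBasis N) (bg9YR (Matrix (Fin N) (Fin N) ℂ) (specialUnitaryUnits (Fin N)) R₁ R₂ x) (fun U => U) U
  Dstar := fun U => DscoK x.toKIdx (trBasis N) (bg9YR (Matrix (Fin N) (Fin N) ℂ) (specialUnitaryUnits (Fin N)) R₁ R₂ x) (fun U => U) U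
  Q := fun U =>
    QcoKHq x.toKIdx (trBasis N) (bg9YR (Matrix (Fin N) (Fin N) ℂ) (specialUnitaryUnits (Fin N)) R₁ R₂ x) (fun U => U) (𝔮 x.toKIdx) U
  Qstar := fun U =>
    QscoKHq x.toKIdx (trBasis N) (bg9YR (Matrix (Fin N) (Fin N) ℂ) (specialUnitaryUnits (Fin N)) R₁ R₂ x) (fun U => U) (𝔮s x.toKIdx) U
  C := fun U =>
    CcoKq x.toKIdx (trBasis N) (bg9YR (Matrix (Fin N) (Fin N) ℂ) (specialUnitaryUnits (Fin N)) R₁ R₂ x) (fun U => U) (𝔮 x.toKIdx) (𝔮s x.toKIdx)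
      (parS x.toKIdx) (GpPhysY x.toKIdx (parS x.toKIdx)) U
  C1 := fun U =>
    C1coKq x.toKIdx (trBasis N) (bg9YR (Matrix (Fin N) (Fin N) ℂ) (specialUnitaryUnits (Fin N)) R₁ R₂ x) (fun U => U) (𝔮 x.toKIdx) (𝔮s x.toKIdx)
      (parS x.toKIdx) (GpPhysY x.toKIdx (parS x.toKIdx)) (𝔯 x).Δ2 U
  Hm := fun U =>
    HcoK x.toKIdx (trBasis N) (bg9YR (Matrix (Fin N) (Fin N) ℂ) (specialUnitaryUnits (Fin N)) R₁ R₂ x) (fun U => U)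
      (𝔏 x).H U
  H1m := fun U =>
    HcoK x.toKIdx (trBasis N) (bg9YR (Matrix (Fin N) (Fin N) ℂ) (specialUnitaryUnits (Fin N)) R₁ R₂ x) (fun U => U)
      (𝔏 x).H₁ U
  Dv := fun U => DvcoKH x.toKIdx (trBasis N) (bg9YR (Matrix (Fin N) (Fin N) ℂ) (specialUnitaryUnits (Fin N)) R₁ R₂ x) (fun U => U) U
  Dvstar := fun U => DvscoKH x.toKIdx (trBasis N) (bg9YR (Matrix (Fin N) (Fin N) ℂ) (specialUnitaryUnits (Fin N)) R₁ R₂ x) (fun U => U) U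
  R := fun U =>
    RcoK x.toKIdx (trBasis N) (bg9YR (Matrix (Fin N) (Fin N) ℂ) (specialUnitaryUnits (Fin N)) R₁ R₂ x) (fun U => U) (parS x.toKIdx)
      (GpPhysY x.toKIdx (parS x.toKIdx)) U

end Record

/-! ## §2 The twenty-two faces of the parametric record, field by field (`rfl` by projection), in the certificate's binder shapes over `(𝔏, 𝔮, 𝔮⋆, parS)` -/

section Faces

variable (N : ℕ) (θ : Stage3Params) (Mstar : ℕ) (𝔯 : ResY N θ Mstar)
  (R₁ R₂ : RegFamY θ.d₆ θ.ℓ₆ θ.hd' θ.hL' θ.b₀ θ.b₁ Mstar (Matrix (Fin N) (Fin N) ℂ))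
  (bI : ∀ x : MemberY θ.d₆ θ.ℓ₆ θ.hd' θ.hL' θ.b₀ θ.b₁ Mstar, FBondY x.toKIdx → IBondY x.toKIdx)
  (𝔏 : LettersY N θ Mstar) (𝔮 : QFamY N θ) (𝔮s : QsFamY N θ)
  (parS : ∀ i : KIdx θ.d₆ θ.ℓ₆ θ.hd' θ.hL' θ.b₀ θ.b₁, SiteParY (Matrix (Fin N) (Fin N) ℂ) i)
  (x : MemberY θ.d₆ θ.ℓ₆ θ.hd' θ.hL' θ.b₀ θ.b₁ Mstar)

/-- face `blk` (pin `hblk12`). [cite: Balaban1985BackgroundPropagators, (3.120)–(3.153) pp.419–426, bookkeeping] -/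
theorem ops312YOfRecordPar_blk : (ops312YOfRecordPar N θ Mstar 𝔯 R₁ R₂ bI 𝔏 𝔮 𝔮s parS x).blk = blkBK x.toKIdx (bI x) := by
  dsimp only [ops312YOfRecordPar]

/-- face `blkW` (pin `hblkW12`). [cite: Balaban1985BackgroundPropagators, (3.120)–(3.153) pp.419–426, bookkeeping] -/
theorem ops312YOfRecordPar_blkW : (ops312YOfRecordPar N θ Mstar 𝔯 R₁ R₂ bI 𝔏 𝔮 𝔮s parS x).blkW = blkSK x.toKIdx (sIK x.toKIdx (bI x)) := by
  dsimp only [ops312YOfRecordPar]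

/-- face `blkY` (pin `hblkY12`). [cite: Balaban1985BackgroundPropagators, (3.120)–(3.153) pp.419–426, bookkeeping] -/
theorem ops312YOfRecordPar_blkY : (ops312YOfRecordPar N θ Mstar 𝔯 R₁ R₂ bI 𝔏 𝔮 𝔮s parS x).blkY = blkBK x.toKIdx (bI x) := by
  dsimp only [ops312YOfRecordPar]

/-- face `G0` = `GcoK` of the letter `GA` of record (pin `hG0co12`). [cite: Balaban1985BackgroundPropagators, p.421 («G₀»), (3.42) p.397] -/
theorem ops312YOfRecordPar_G0 (U : (bg9YR (Matrix (Fin N) (Fin N) ℂ) (specialUnitaryUnits (Fin N)) R₁ R₂ x).Cfg) :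
    (ops312YOfRecordPar N θ Mstar 𝔯 R₁ R₂ bI 𝔏 𝔮 𝔮s parS x).G0 U = GcoK x.toKIdx (trBasis N) (bg9YR (Matrix (Fin N) (Fin N) ℂ) (specialUnitaryUnits (Fin N)) R₁ R₂ x)
      (fun U => U) (𝔏 x).GA U := by
  dsimp only [ops312YOfRecordPar]

/-- face `G` = `GcoK` of the letter `GD` of record (pin `hGco12`). [cite: Balaban1985BackgroundPropagators, (3.122) p.420] -/
theorem ops312YOfRecordPar_G (U : (bg9YR (Matrix (Fin N) (Fin N) ℂ) (specialUnitaryUnits (Fin N)) R₁ R₂ x).Cfg) :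
    (ops312YOfRecordPar N θ Mstar 𝔯 R₁ R₂ bI 𝔏 𝔮 𝔮s parS x).G U = GcoK x.toKIdx (trBasis N) (bg9YR (Matrix (Fin N) (Fin N) ℂ) (specialUnitaryUnits (Fin N)) R₁ R₂ x)
      (fun U => U) (𝔏 x).GD U := by
  dsimp only [ops312YOfRecordPar]

/-- face `G1` = `GcoK` of the letter `G₁` of record (pin `hG1co12`). [cite: Balaban1985BackgroundPropagators, (3.128) p.421] -/
theorem ops312YOfRecordPar_G1 (U : (bg9YR (Matrix (Fin N) (Fin N) ℂ) (specialUnitaryUnits (Fin N)) R₁ R₂ x).Cfg) :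
    (ops312YOfRecordPar N θ Mstar 𝔯 R₁ R₂ bI 𝔏 𝔮 𝔮s parS x).G1 U = GcoK x.toKIdx (trBasis N) (bg9YR (Matrix (Fin N) (Fin N) ℂ) (specialUnitaryUnits (Fin N)) R₁ R₂ x)
      (fun U => U) (𝔏 x).G₁ U := by
  dsimp only [ops312YOfRecordPar]

/-- face `GG` = `GcoK` of the letter `GG` (`𝔊`) of record (pin `hGGco12`). [cite: Balaban1985BackgroundPropagators, (3.148) p.425, (3.153) p.426] -/
theorem ops312YOfRecordPar_GG (U : (bg9YR (Matrix (Fin N) (Fin N) ℂ) (specialUnitaryUnits (Fin N)) R₁ R₂ x).Cfg) :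
    (ops312YOfRecordPar N θ Mstar 𝔯 R₁ R₂ bI 𝔏 𝔮 𝔮s parS x).GG U = GcoK x.toKIdx (trBasis N) (bg9YR (Matrix (Fin N) (Fin N) ℂ) (specialUnitaryUnits (Fin N)) R₁ R₂ x)
      (fun U => U) (𝔏 x).GG U := by
  dsimp only [ops312YOfRecordPar]

/-- face `D` = `DcoK` (pin `hDco12`). [cite: Balaban1985BackgroundPropagators, (3.42) p.397 («∇_U G(U)»)] -/
theorem ops312YOfRecordPar_D (U : (bg9YR (Matrix (Fin N) (Fin N) ℂ) (specialUnitaryUnits (Fin N)) R₁ R₂ x).Cfg) :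
    (ops312YOfRecordPar N θ Mstar 𝔯 R₁ R₂ bI 𝔏 𝔮 𝔮s parS x).D U =
      DcoK x.toKIdx (trBasis N) (bg9YR (Matrix (Fin N) (Fin N) ℂ) (specialUnitaryUnits (Fin N)) R₁ R₂ x) (fun U => U) U := by
  dsimp only [ops312YOfRecordPar]

/-- face `Dstar` = `DscoK` (pin `hDsco12`). [cite: Balaban1985BackgroundPropagators, (3.42) p.397 («G(U)∇*_U»)] -/
theorem ops312YOfRecordPar_Dstar (U : (bg9YR (Matrix (Fin N) (Fin N) ℂ) (specialUnitaryUnits (Fin N)) R₁ R₂ x).Cfg) :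
    (ops312YOfRecordPar N θ Mstar 𝔯 R₁ R₂ bI 𝔏 𝔮 𝔮s parS x).Dstar U =
      DscoK x.toKIdx (trBasis N) (bg9YR (Matrix (Fin N) (Fin N) ℂ) (specialUnitaryUnits (Fin N)) R₁ R₂ x) (fun U => U) U := by
  dsimp only [ops312YOfRecordPar]

/-- face `blkZ` (pin `hblkZ12`). [cite: Balaban1985BackgroundPropagators, (3.120)–(3.153) pp.419–426, bookkeeping] -/
theorem ops312YOfRecordPar_blkZ : (ops312YOfRecordPar N θ Mstar 𝔯 R₁ R₂ bI 𝔏 𝔮 𝔮s parS x).blkZ = blkHK x.toKIdx := by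
  dsimp only [ops312YOfRecordPar]

/-- face `Hm` = `HcoK` of the letter `H` of record (pin `hHm12`). [cite: Balaban1985BackgroundPropagators, (3.126) p.420] -/
theorem ops312YOfRecordPar_Hm (U : (bg9YR (Matrix (Fin N) (Fin N) ℂ) (specialUnitaryUnits (Fin N)) R₁ R₂ x).Cfg) :
    (ops312YOfRecordPar N θ Mstar 𝔯 R₁ R₂ bI 𝔏 𝔮 𝔮s parS x).Hm U = HcoK x.toKIdx (trBasis N) (bg9YR (Matrix (Fin N) (Fin N) ℂ) (specialUnitaryUnits (Fin N)) R₁ R₂ x)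
      (fun U => U) (𝔏 x).H U := by
  dsimp only [ops312YOfRecordPar]

/-- face `H1m` = `HcoK` of the letter `H₁` of record (pin `hH1m12`). [cite: Balaban1985BackgroundPropagators, (3.129) p.421] -/
theorem ops312YOfRecordPar_H1m (U : (bg9YR (Matrix (Fin N) (Fin N) ℂ) (specialUnitaryUnits (Fin N)) R₁ R₂ x).Cfg) :
    (ops312YOfRecordPar N θ Mstar 𝔯 R₁ R₂ bI 𝔏 𝔮 𝔮s parS x).H1m U = HcoK x.toKIdx (trBasis N) (bg9YR (Matrix (Fin N) (Fin N) ℂ) (specialUnitaryUnits (Fin N)) R₁ R₂ x)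
      (fun U => U) (𝔏 x).H₁ U := by
  dsimp only [ops312YOfRecordPar]

/-- face `S0` = `S0coK` at the record (pin `hS0co12`). [cite: Balaban1985BackgroundPropagators, (3.26) p.395, p.421 («G₀»), Thm 3.11 p.416] -/
theorem ops312YOfRecordPar_S0 (U : (bg9YR (Matrix (Fin N) (Fin N) ℂ) (specialUnitaryUnits (Fin N)) R₁ R₂ x).Cfg) :
    (ops312YOfRecordPar N θ Mstar 𝔯 R₁ R₂ bI 𝔏 𝔮 𝔮s parS x).S0 U = S0coKq x.toKIdx (trBasis N) (bg9YR (Matrix (Fin N) (Fin N) ℂ) (specialUnitaryUnits (Fin N)) R₁ R₂ x)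
      (fun U => U) (𝔮 x.toKIdx) (𝔮s x.toKIdx) (parS x.toKIdx) (GpPhysY x.toKIdx (parS x.toKIdx)) U := by
  dsimp only [ops312YOfRecordPar]

/-- face `Tpi` = `TpicoK` at the record (pin `hTpico12`). [cite: Balaban1985BackgroundPropagators, (3.121) p.420] -/
theorem ops312YOfRecordPar_Tpi (U : (bg9YR (Matrix (Fin N) (Fin N) ℂ) (specialUnitaryUnits (Fin N)) R₁ R₂ x).Cfg) :
    (ops312YOfRecordPar N θ Mstar 𝔯 R₁ R₂ bI 𝔏 𝔮 𝔮s parS x).Tpi U = TpicoK x.toKIdx (trBasis N) (bg9YR (Matrix (Fin N) (Fin N) ℂ) (specialUnitaryUnits (Fin N)) R₁ R₂ x)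
      (fun U => U) (parS x.toKIdx) (GpPhysY x.toKIdx (parS x.toKIdx)) U := by
  dsimp only [ops312YOfRecordPar]

/-- face `T2` = `T2coK` at the record and the residual letter `(𝔯 x).Δ2` (pin `hT2co12`). [cite: Balaban1985BackgroundPropagators, (3.135) p.422] -/
theorem ops312YOfRecordPar_T2 (U : (bg9YR (Matrix (Fin N) (Fin N) ℂ) (specialUnitaryUnits (Fin N)) R₁ R₂ x).Cfg) :
    (ops312YOfRecordPar N θ Mstar 𝔯 R₁ R₂ bI 𝔏 𝔮 𝔮s parS x).T2 U = T2coK x.toKIdx (trBasis N) (bg9YR (Matrix (Fin N) (Fin N) ℂ) (specialUnitaryUnits (Fin N)) R₁ R₂ x)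
      (fun U => U) (parS x.toKIdx) (GpPhysY x.toKIdx (parS x.toKIdx)) (𝔯 x).Δ2 U := by
  dsimp only [ops312YOfRecordPar]

/-- face `Q` = `QcoKH` at the bond transporter of record (pin `hQco12`). [cite: Balaban1985BackgroundPropagators, (3.13) p.393, (3.35) p.396, (3.110) p.418] -/
theorem ops312YOfRecordPar_Q (U : (bg9YR (Matrix (Fin N) (Fin N) ℂ) (specialUnitaryUnits (Fin N)) R₁ R₂ x).Cfg) :
    (ops312YOfRecordPar N θ Mstar 𝔯 R₁ R₂ bI 𝔏 𝔮 𝔮s parS x).Q U = QcoKHq x.toKIdx (trBasis N) (bg9YR (Matrix (Fin N) (Fin N) ℂ) (specialUnitaryUnits (Fin N)) R₁ R₂ x)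
      (fun U => U) (𝔮 x.toKIdx) U := by
  dsimp only [ops312YOfRecordPar]

/-- face `Qstar` = `QscoKH` at the bond transporter of record (pin `hQsco12`). [cite: Balaban1985BackgroundPropagators, (3.13) p.393 (Q* the adjoint of Q)] -/
theorem ops312YOfRecordPar_Qstar (U : (bg9YR (Matrix (Fin N) (Fin N) ℂ) (specialUnitaryUnits (Fin N)) R₁ R₂ x).Cfg) :
    (ops312YOfRecordPar N θ Mstar 𝔯 R₁ R₂ bI 𝔏 𝔮 𝔮s parS x).Qstar U = QscoKHq x.toKIdx (trBasis N) (bg9YR (Matrix (Fin N) (Fin N) ℂ) (specialUnitaryUnits (Fin N)) R₁ R₂ x)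
      (fun U => U) (𝔮s x.toKIdx) U := by
  dsimp only [ops312YOfRecordPar]

/-- face `C` = `CcoK` at the record (pin `hCco12`). [cite: Balaban1985BackgroundPropagators, (3.123) p.420, (3.132) p.422] -/
theorem ops312YOfRecordPar_C (U : (bg9YR (Matrix (Fin N) (Fin N) ℂ) (specialUnitaryUnits (Fin N)) R₁ R₂ x).Cfg) :
    (ops312YOfRecordPar N θ Mstar 𝔯 R₁ R₂ bI 𝔏 𝔮 𝔮s parS x).C U = CcoKq x.toKIdx (trBasis N) (bg9YR (Matrix (Fin N) (Fin N) ℂ) (specialUnitaryUnits (Fin N)) R₁ R₂ x)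
      (fun U => U) (𝔮 x.toKIdx) (𝔮s x.toKIdx) (parS x.toKIdx) (GpPhysY x.toKIdx (parS x.toKIdx)) U := by
  dsimp only [ops312YOfRecordPar]

/-- face `C1` = `C1coK` at the record and the residual letter `(𝔯 x).Δ2` (pin `hC1co12`). [cite: Balaban1985BackgroundPropagators, (3.132) p.422] -/
theorem ops312YOfRecordPar_C1 (U : (bg9YR (Matrix (Fin N) (Fin N) ℂ) (specialUnitaryUnits (Fin N)) R₁ R₂ x).Cfg) :
    (ops312YOfRecordPar N θ Mstar 𝔯 R₁ R₂ bI 𝔏 𝔮 𝔮s parS x).C1 U = C1coKq x.toKIdx (trBasis N) (bg9YR (Matrix (Fin N) (Fin N) ℂ) (specialUnitaryUnits (Fin N)) R₁ R₂ x)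
      (fun U => U) (𝔮 x.toKIdx) (𝔮s x.toKIdx) (parS x.toKIdx) (GpPhysY x.toKIdx (parS x.toKIdx)) (𝔯 x).Δ2 U := by
  dsimp only [ops312YOfRecordPar]

/-- face `Dv` = `DvcoKH` (pin `hDvco12`). [cite: Balaban1985BackgroundPropagators, (3.6) p.391, (3.124) p.420] -/
theorem ops312YOfRecordPar_Dv (U : (bg9YR (Matrix (Fin N) (Fin N) ℂ) (specialUnitaryUnits (Fin N)) R₁ R₂ x).Cfg) :
    (ops312YOfRecordPar N θ Mstar 𝔯 R₁ R₂ bI 𝔏 𝔮 𝔮s parS x).Dv U =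
      DvcoKH x.toKIdx (trBasis N) (bg9YR (Matrix (Fin N) (Fin N) ℂ) (specialUnitaryUnits (Fin N)) R₁ R₂ x) (fun U => U) U := by
  dsimp only [ops312YOfRecordPar]

/-- face `Dvstar` = `DvscoKH` (pin `hDvsco12`). [cite: Balaban1985BackgroundPropagators, (3.8) p.392, (3.124) p.420] -/
theorem ops312YOfRecordPar_Dvstar (U : (bg9YR (Matrix (Fin N) (Fin N) ℂ) (specialUnitaryUnits (Fin N)) R₁ R₂ x).Cfg) :
    (ops312YOfRecordPar N θ Mstar 𝔯 R₁ R₂ bI 𝔏 𝔮 𝔮s parS x).Dvstar U =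
      DvscoKH x.toKIdx (trBasis N) (bg9YR (Matrix (Fin N) (Fin N) ℂ) (specialUnitaryUnits (Fin N)) R₁ R₂ x) (fun U => U) U := by
  dsimp only [ops312YOfRecordPar]

/-- face `R` = `RcoK` at the record (pin `hRco12`). [cite: Balaban1985BackgroundPropagators, (3.25) p.394, Thm 3.11 p.416] -/
theorem ops312YOfRecordPar_R (U : (bg9YR (Matrix (Fin N) (Fin N) ℂ) (specialUnitaryUnits (Fin N)) R₁ R₂ x).Cfg) :
    (ops312YOfRecordPar N θ Mstar 𝔯 R₁ R₂ bI 𝔏 𝔮 𝔮s parS x).R U = RcoK x.toKIdx (trBasis N) (bg9YR (Matrix (Fin N) (Fin N) ℂ) (specialUnitaryUnits (Fin N)) R₁ R₂ x)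
      (fun U => U) (parS x.toKIdx) (GpPhysY x.toKIdx (parS x.toKIdx)) U := by
  dsimp only [ops312YOfRecordPar]

end Faces

/-! ## §3 The two instances: today's record by `rfl`, and the KNIT record of the CASCADE-K certificate -/

section Instances

variable (N : ℕ) (θ : Stage3Params) (Mstar : ℕ) (𝔯 : ResY N θ Mstar)
  (R₁ R₂ : RegFamY θ.d₆ θ.ℓ₆ θ.hd' θ.hL' θ.b₀ θ.b₁ Mstar (Matrix (Fin N) (Fin N) ℂ))
  (bI : ∀ x : MemberY θ.d₆ θ.ℓ₆ θ.hd' θ.hL' θ.b₀ θ.b₁ Mstar, FBondY x.toKIdx → IBondY x.toKIdx)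

/-- ★★ **TODAY'S SECT.-D OPERATOR RECORD IS THE PARAMETRIC RECORD** at the letters of record `lettersYOfRecordV4P N θ M⋆ 𝔯`, the straight-contour averaging pair of
record `(qYOfRecord N θ, qsYOfRecord N θ) = (i ↦ QY i (parBY i), i ↦ QsY i (parBY i))` and the symmetrised site transporter `parSymY` — by unfolding both records and
the §0 faces `…_QY` (field by field definitional; stated as one equation of families), so every consumer of `Node00.OpsYOps312OfRecord` re-keys along it.
[cite: Balaban1985BackgroundPropagators, (3.120)–(3.153) pp.419–426, bookkeeping] -/
theorem ops312YOfRecord_eq_par :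
    ops312YOfRecord N θ Mstar 𝔯 R₁ R₂ bI =
      ops312YOfRecordPar N θ Mstar 𝔯 R₁ R₂ bI (lettersYOfRecordV4P N θ Mstar 𝔯) (qYOfRecord N θ) (qsYOfRecord N θ) parSymY := by
  funext x
  dsimp only [ops312YOfRecord, ops312YOfRecordPar, qYOfRecord, qsYOfRecord, S0coKq_QY, QcoKHq_QY, QscoKHq_QY, CcoKq_QY, C1coKq_QY]

variable [Nonempty (Fin N)]

/-- ★★★ **THE KNIT SECT.-D OPERATOR RECORD OF STAGE 3′(Y)** at the member `x` — the parametric record at the KNIT letters of record `lettersYOfRecordV11K N θ M⋆ 𝔯`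
(`Node00.OpsYRecordV11`), print's averaging pair of (3.115) `(qKnitOfRecord N θ, qsKnitOfRecord N θ)` (`Node00.OpsYQLetter`; dag-n06-l's `QknitY`) and print's knit
site transporter `parKnitY` ([Balaban1985Averaging] Prop. 2): the `𝔬12` the CASCADE-K certificate «K» binds (`h𝔬12 : 𝔬12 = ops312YOfRecordK N θ M⋆ 𝔯 R₁ R₂ bI`,
§4 `pins312K_of_eq`).  A parameter record; nothing of [B9] is asserted.
[cite: Balaban1985BackgroundPropagators, Thm 3.12 p.423, Thm 3.13 p.426, (3.115) p.418, (3.120)–(3.153) pp.419–426] [cite: Balaban1985Averaging, Prop. 2 p.26, (15) p.19] -/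
def ops312YOfRecordK (x : MemberY θ.d₆ θ.ℓ₆ θ.hd' θ.hL' θ.b₀ θ.b₁ Mstar) :
    B9Thm312Whole.Ops (geo9Y x) (bg9YR (Matrix (Fin N) (Fin N) ℂ) (specialUnitaryUnits (Fin N)) R₁ R₂ x)
      (XBK (TrIdx N) x.toKIdx) (XBK (TrIdx N) x.toKIdx) (XHK (TrIdx N) x.toKIdx) (XSK (TrIdx N) x.toKIdx) :=
  ops312YOfRecordPar N θ Mstar 𝔯 R₁ R₂ bI (lettersYOfRecordV11K N θ Mstar 𝔯) (qKnitOfRecord N θ) (qsKnitOfRecord N θ) parKnitY x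

/-- the knit record IS the parametric record at `(lettersYOfRecordV11K N θ M⋆ 𝔯, qKnitOfRecord N θ, qsKnitOfRecord N θ, parKnitY)` (`rfl`).
[cite: Balaban1985BackgroundPropagators, (3.120)–(3.153) pp.419–426, bookkeeping] -/
theorem ops312YOfRecordK_eq :
    ops312YOfRecordK N θ Mstar 𝔯 R₁ R₂ bI =
      ops312YOfRecordPar N θ Mstar 𝔯 R₁ R₂ bI (lettersYOfRecordV11K N θ Mstar 𝔯) (qKnitOfRecord N θ) (qsKnitOfRecord N θ) parKnitY := rfl

variable (x : MemberY θ.d₆ θ.ℓ₆ θ.hd' θ.hL' θ.b₀ θ.b₁ Mstar) (U : (bg9YR (Matrix (Fin N) (Fin N) ℂ) (specialUnitaryUnits (Fin N)) R₁ R₂ x).Cfg)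

/-- knit face `Q` = `QcoKHq` at print's averaging of record. [cite: Balaban1985BackgroundPropagators, (3.115) p.418, (3.13) p.393] -/
theorem ops312YOfRecordK_Q : (ops312YOfRecordK N θ Mstar 𝔯 R₁ R₂ bI x).Q U =
    QcoKHq x.toKIdx (trBasis N) (bg9YR (Matrix (Fin N) (Fin N) ℂ) (specialUnitaryUnits (Fin N)) R₁ R₂ x) (fun U => U) (qKnitOfRecord N θ x.toKIdx) U := by
  dsimp only [ops312YOfRecordK, ops312YOfRecordPar]

/-- knit face `Qstar` = `QscoKHq` at the adjoint averaging of record. [cite: Balaban1985BackgroundPropagators, (3.115) p.418, (3.13) p.393 (Q* the adjoint of Q)] -/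
theorem ops312YOfRecordK_Qstar : (ops312YOfRecordK N θ Mstar 𝔯 R₁ R₂ bI x).Qstar U =
    QscoKHq x.toKIdx (trBasis N) (bg9YR (Matrix (Fin N) (Fin N) ℂ) (specialUnitaryUnits (Fin N)) R₁ R₂ x) (fun U => U) (qsKnitOfRecord N θ x.toKIdx) U := by
  dsimp only [ops312YOfRecordK, ops312YOfRecordPar]

/-- knit face `S0` = `S0coKq` at the knit pair and transporter. [cite: Balaban1985BackgroundPropagators, (3.26) p.395, p.421 («G₀»), (3.115) p.418] -/
theorem ops312YOfRecordK_S0 : (ops312YOfRecordK N θ Mstar 𝔯 R₁ R₂ bI x).S0 U =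
    S0coKq x.toKIdx (trBasis N) (bg9YR (Matrix (Fin N) (Fin N) ℂ) (specialUnitaryUnits (Fin N)) R₁ R₂ x) (fun U => U) (qKnitOfRecord N θ x.toKIdx)
      (qsKnitOfRecord N θ x.toKIdx) (parKnitY x.toKIdx) (GpPhysY x.toKIdx (parKnitY x.toKIdx)) U := by
  dsimp only [ops312YOfRecordK, ops312YOfRecordPar]

/-- knit face `C` = `CcoKq` at the knit pair and transporter. [cite: Balaban1985BackgroundPropagators, (3.123) p.420, (3.132) p.422, (3.115) p.418] -/
theorem ops312YOfRecordK_C : (ops312YOfRecordK N θ Mstar 𝔯 R₁ R₂ bI x).C U =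
    CcoKq x.toKIdx (trBasis N) (bg9YR (Matrix (Fin N) (Fin N) ℂ) (specialUnitaryUnits (Fin N)) R₁ R₂ x) (fun U => U) (qKnitOfRecord N θ x.toKIdx)
      (qsKnitOfRecord N θ x.toKIdx) (parKnitY x.toKIdx) (GpPhysY x.toKIdx (parKnitY x.toKIdx)) U := by
  dsimp only [ops312YOfRecordK, ops312YOfRecordPar]

/-- knit face `C1` = `C1coKq` at the knit pair and transporter, residual letter `(𝔯 x).Δ2`. [cite: Balaban1985BackgroundPropagators, (3.132) p.422, (3.128) p.421, (3.115) p.418] -/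
theorem ops312YOfRecordK_C1 : (ops312YOfRecordK N θ Mstar 𝔯 R₁ R₂ bI x).C1 U =
    C1coKq x.toKIdx (trBasis N) (bg9YR (Matrix (Fin N) (Fin N) ℂ) (specialUnitaryUnits (Fin N)) R₁ R₂ x) (fun U => U) (qKnitOfRecord N θ x.toKIdx)
      (qsKnitOfRecord N θ x.toKIdx) (parKnitY x.toKIdx) (GpPhysY x.toKIdx (parKnitY x.toKIdx)) (𝔯 x).Δ2 U := by
  dsimp only [ops312YOfRecordK, ops312YOfRecordPar]

/-- knit face `G1` = `GcoK` of the knit letter `G₁` of record. [cite: Balaban1985BackgroundPropagators, (3.128) p.421, (3.115) p.418] -/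
theorem ops312YOfRecordK_G1 : (ops312YOfRecordK N θ Mstar 𝔯 R₁ R₂ bI x).G1 U =
    GcoK x.toKIdx (trBasis N) (bg9YR (Matrix (Fin N) (Fin N) ℂ) (specialUnitaryUnits (Fin N)) R₁ R₂ x) (fun U => U) (lettersYOfRecordV11K N θ Mstar 𝔯 x).G₁ U := by
  dsimp only [ops312YOfRecordK, ops312YOfRecordPar]

/-- knit face `R` = `RcoK` at print's knit transporter. [cite: Balaban1985BackgroundPropagators, (3.25) p.394, Thm 3.11 p.416] [cite: Balaban1985Averaging, Prop. 2 p.26] -/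
theorem ops312YOfRecordK_R : (ops312YOfRecordK N θ Mstar 𝔯 R₁ R₂ bI x).R U =
    RcoK x.toKIdx (trBasis N) (bg9YR (Matrix (Fin N) (Fin N) ℂ) (specialUnitaryUnits (Fin N)) R₁ R₂ x) (fun U => U) (parKnitY x.toKIdx)
      (GpPhysY x.toKIdx (parKnitY x.toKIdx)) U := by
  dsimp only [ops312YOfRecordK, ops312YOfRecordPar]

end Instances

/-! ## §4 The twenty-two pins from one equation: parametric, and at the knit instance -/

section Pins

variable {N : ℕ} {θ : Stage3Params} {Mstar : ℕ} {𝔯 : ResY N θ Mstar}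
  {R₁ R₂ : RegFamY θ.d₆ θ.ℓ₆ θ.hd' θ.hL' θ.b₀ θ.b₁ Mstar (Matrix (Fin N) (Fin N) ℂ)}
  {bI : ∀ x : MemberY θ.d₆ θ.ℓ₆ θ.hd' θ.hL' θ.b₀ θ.b₁ Mstar, FBondY x.toKIdx → IBondY x.toKIdx}
  {𝔏 : LettersY N θ Mstar} {𝔮 : QFamY N θ} {𝔮s : QsFamY N θ}
  {parS : ∀ i : KIdx θ.d₆ θ.ℓ₆ θ.hd' θ.hL' θ.b₀ θ.b₁, SiteParY (Matrix (Fin N) (Fin N) ℂ) i}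

/-- ★★★ **THE TWENTY-TWO PINS FROM ONE EQUATION, PARAMETRIC**: if the certificate's Sect.-D operator family `𝔬12` IS the parametric record,
`𝔬12 = ops312YOfRecordPar N θ M⋆ 𝔯 R₁ R₂ bI 𝔏 𝔮 𝔮⋆ parS`, then the twenty-two displayed hypotheses `hblk12, hblkW12, hblkY12, hG0co12, hGco12, hG1co12, hGGco12,
hDco12, hDsco12, hblkZ12, hHm12, hH1m12, hS0co12, hTpico12, hT2co12, hQco12, hQsco12, hCco12, hC1co12, hDvco12, hDvsco12, hRco12` hold in exactly the shapes and
ORDER of `Node00.OpsYOps312OfRecord.pins312_of_eq`, read over `(𝔏 x, 𝔮 x.toKIdx, 𝔮⋆ x.toKIdx, parS x.toKIdx)`; every parameter is implicit (read off `h𝔬12`).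
Usage: `obtain ⟨hblk12, …, hRco12⟩ := OpsYOps312OfRecordPar.pins312Par_of_eq h𝔬12`; at the knit instance use §3 `pins312K_of_eq`.
[cite: Balaban1985BackgroundPropagators, Thm 3.12 p.423, Thm 3.13 p.426, (3.120)–(3.153) pp.419–426, bookkeeping] -/
theorem pins312Par_of_eq
    {𝔬12 : ∀ x : MemberY θ.d₆ θ.ℓ₆ θ.hd' θ.hL' θ.b₀ θ.b₁ Mstar, B9Thm312Whole.Ops (geo9Y x)
      (bg9YR (Matrix (Fin N) (Fin N) ℂ) (specialUnitaryUnits (Fin N)) R₁ R₂ x) (XBK (TrIdx N) x.toKIdx) (XBK (TrIdx N) x.toKIdx)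
      (XHK (TrIdx N) x.toKIdx) (XSK (TrIdx N) x.toKIdx)}
    (h𝔬12 : 𝔬12 = ops312YOfRecordPar N θ Mstar 𝔯 R₁ R₂ bI 𝔏 𝔮 𝔮s parS) :
    (∀ x : MemberY θ.d₆ θ.ℓ₆ θ.hd' θ.hL' θ.b₀ θ.b₁ Mstar, (𝔬12 x).blk = blkBK x.toKIdx (bI x)) ∧
    (∀ x : MemberY θ.d₆ θ.ℓ₆ θ.hd' θ.hL' θ.b₀ θ.b₁ Mstar, (𝔬12 x).blkW = blkSK x.toKIdx (sIK x.toKIdx (bI x))) ∧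
    (∀ x : MemberY θ.d₆ θ.ℓ₆ θ.hd' θ.hL' θ.b₀ θ.b₁ Mstar, (𝔬12 x).blkY = blkBK x.toKIdx (bI x)) ∧
    (∀ (x : MemberY θ.d₆ θ.ℓ₆ θ.hd' θ.hL' θ.b₀ θ.b₁ Mstar) (U : (bg9YR (Matrix (Fin N) (Fin N) ℂ) (specialUnitaryUnits (Fin N)) R₁ R₂ x).Cfg),
      (𝔬12 x).G0 U = GcoK x.toKIdx (trBasis N) (bg9YR (Matrix (Fin N) (Fin N) ℂ) (specialUnitaryUnits (Fin N)) R₁ R₂ x) (fun U => U)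
        (𝔏 x).GA U) ∧
    (∀ (x : MemberY θ.d₆ θ.ℓ₆ θ.hd' θ.hL' θ.b₀ θ.b₁ Mstar) (U : (bg9YR (Matrix (Fin N) (Fin N) ℂ) (specialUnitaryUnits (Fin N)) R₁ R₂ x).Cfg),
      (𝔬12 x).G U = GcoK x.toKIdx (trBasis N) (bg9YR (Matrix (Fin N) (Fin N) ℂ) (specialUnitaryUnits (Fin N)) R₁ R₂ x) (fun U => U)
        (𝔏 x).GD U) ∧
    (∀ (x : MemberY θ.d₆ θ.ℓ₆ θ.hd' θ.hL' θ.b₀ θ.b₁ Mstar) (U : (bg9YR (Matrix (Fin N) (Fin N) ℂ) (specialUnitaryUnits (Fin N)) R₁ R₂ x).Cfg),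
      (𝔬12 x).G1 U = GcoK x.toKIdx (trBasis N) (bg9YR (Matrix (Fin N) (Fin N) ℂ) (specialUnitaryUnits (Fin N)) R₁ R₂ x) (fun U => U)
        (𝔏 x).G₁ U) ∧
    (∀ (x : MemberY θ.d₆ θ.ℓ₆ θ.hd' θ.hL' θ.b₀ θ.b₁ Mstar) (U : (bg9YR (Matrix (Fin N) (Fin N) ℂ) (specialUnitaryUnits (Fin N)) R₁ R₂ x).Cfg),
      (𝔬12 x).GG U = GcoK x.toKIdx (trBasis N) (bg9YR (Matrix (Fin N) (Fin N) ℂ) (specialUnitaryUnits (Fin N)) R₁ R₂ x) (fun U => U)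
        (𝔏 x).GG U) ∧
    (∀ (x : MemberY θ.d₆ θ.ℓ₆ θ.hd' θ.hL' θ.b₀ θ.b₁ Mstar) (U : (bg9YR (Matrix (Fin N) (Fin N) ℂ) (specialUnitaryUnits (Fin N)) R₁ R₂ x).Cfg),
      (𝔬12 x).D U = DcoK x.toKIdx (trBasis N) (bg9YR (Matrix (Fin N) (Fin N) ℂ) (specialUnitaryUnits (Fin N)) R₁ R₂ x) (fun U => U) U) ∧
    (∀ (x : MemberY θ.d₆ θ.ℓ₆ θ.hd' θ.hL' θ.b₀ θ.b₁ Mstar) (U : (bg9YR (Matrix (Fin N) (Fin N) ℂ) (specialUnitaryUnits (Fin N)) R₁ R₂ x).Cfg),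
      (𝔬12 x).Dstar U = DscoK x.toKIdx (trBasis N) (bg9YR (Matrix (Fin N) (Fin N) ℂ) (specialUnitaryUnits (Fin N)) R₁ R₂ x) (fun U => U) U) ∧
    (∀ x : MemberY θ.d₆ θ.ℓ₆ θ.hd' θ.hL' θ.b₀ θ.b₁ Mstar, (𝔬12 x).blkZ = blkHK x.toKIdx) ∧
    (∀ (x : MemberY θ.d₆ θ.ℓ₆ θ.hd' θ.hL' θ.b₀ θ.b₁ Mstar) (U : (bg9YR (Matrix (Fin N) (Fin N) ℂ) (specialUnitaryUnits (Fin N)) R₁ R₂ x).Cfg),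
      (𝔬12 x).Hm U = HcoK x.toKIdx (trBasis N) (bg9YR (Matrix (Fin N) (Fin N) ℂ) (specialUnitaryUnits (Fin N)) R₁ R₂ x) (fun U => U)
        (𝔏 x).H U) ∧
    (∀ (x : MemberY θ.d₆ θ.ℓ₆ θ.hd' θ.hL' θ.b₀ θ.b₁ Mstar) (U : (bg9YR (Matrix (Fin N) (Fin N) ℂ) (specialUnitaryUnits (Fin N)) R₁ R₂ x).Cfg),
      (𝔬12 x).H1m U = HcoK x.toKIdx (trBasis N) (bg9YR (Matrix (Fin N) (Fin N) ℂ) (specialUnitaryUnits (Fin N)) R₁ R₂ x) (fun U => U)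
        (𝔏 x).H₁ U) ∧
    (∀ (x : MemberY θ.d₆ θ.ℓ₆ θ.hd' θ.hL' θ.b₀ θ.b₁ Mstar) (U : (bg9YR (Matrix (Fin N) (Fin N) ℂ) (specialUnitaryUnits (Fin N)) R₁ R₂ x).Cfg),
      (𝔬12 x).S0 U = S0coKq x.toKIdx (trBasis N) (bg9YR (Matrix (Fin N) (Fin N) ℂ) (specialUnitaryUnits (Fin N)) R₁ R₂ x) (fun U => U)
        (𝔮 x.toKIdx) (𝔮s x.toKIdx) (parS x.toKIdx) (GpPhysY x.toKIdx (parS x.toKIdx)) U) ∧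
    (∀ (x : MemberY θ.d₆ θ.ℓ₆ θ.hd' θ.hL' θ.b₀ θ.b₁ Mstar) (U : (bg9YR (Matrix (Fin N) (Fin N) ℂ) (specialUnitaryUnits (Fin N)) R₁ R₂ x).Cfg),
      (𝔬12 x).Tpi U = TpicoK x.toKIdx (trBasis N) (bg9YR (Matrix (Fin N) (Fin N) ℂ) (specialUnitaryUnits (Fin N)) R₁ R₂ x) (fun U => U)
        (parS x.toKIdx) (GpPhysY x.toKIdx (parS x.toKIdx)) U) ∧
    (∀ (x : MemberY θ.d₆ θ.ℓ₆ θ.hd' θ.hL' θ.b₀ θ.b₁ Mstar) (U : (bg9YR (Matrix (Fin N) (Fin N) ℂ) (specialUnitaryUnits (Fin N)) R₁ R₂ x).Cfg),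
      (𝔬12 x).T2 U = T2coK x.toKIdx (trBasis N) (bg9YR (Matrix (Fin N) (Fin N) ℂ) (specialUnitaryUnits (Fin N)) R₁ R₂ x) (fun U => U)
        (parS x.toKIdx) (GpPhysY x.toKIdx (parS x.toKIdx)) (𝔯 x).Δ2 U) ∧
    (∀ (x : MemberY θ.d₆ θ.ℓ₆ θ.hd' θ.hL' θ.b₀ θ.b₁ Mstar) (U : (bg9YR (Matrix (Fin N) (Fin N) ℂ) (specialUnitaryUnits (Fin N)) R₁ R₂ x).Cfg),
      (𝔬12 x).Q U = QcoKHq x.toKIdx (trBasis N) (bg9YR (Matrix (Fin N) (Fin N) ℂ) (specialUnitaryUnits (Fin N)) R₁ R₂ x) (fun U => U)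
        (𝔮 x.toKIdx) U) ∧
    (∀ (x : MemberY θ.d₆ θ.ℓ₆ θ.hd' θ.hL' θ.b₀ θ.b₁ Mstar) (U : (bg9YR (Matrix (Fin N) (Fin N) ℂ) (specialUnitaryUnits (Fin N)) R₁ R₂ x).Cfg),
      (𝔬12 x).Qstar U = QscoKHq x.toKIdx (trBasis N) (bg9YR (Matrix (Fin N) (Fin N) ℂ) (specialUnitaryUnits (Fin N)) R₁ R₂ x) (fun U => U)
        (𝔮s x.toKIdx) U) ∧
    (∀ (x : MemberY θ.d₆ θ.ℓ₆ θ.hd' θ.hL' θ.b₀ θ.b₁ Mstar) (U : (bg9YR (Matrix (Fin N) (Fin N) ℂ) (specialUnitaryUnits (Fin N)) R₁ R₂ x).Cfg),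
      (𝔬12 x).C U = CcoKq x.toKIdx (trBasis N) (bg9YR (Matrix (Fin N) (Fin N) ℂ) (specialUnitaryUnits (Fin N)) R₁ R₂ x) (fun U => U)
        (𝔮 x.toKIdx) (𝔮s x.toKIdx) (parS x.toKIdx) (GpPhysY x.toKIdx (parS x.toKIdx)) U) ∧
    (∀ (x : MemberY θ.d₆ θ.ℓ₆ θ.hd' θ.hL' θ.b₀ θ.b₁ Mstar) (U : (bg9YR (Matrix (Fin N) (Fin N) ℂ) (specialUnitaryUnits (Fin N)) R₁ R₂ x).Cfg),
      (𝔬12 x).C1 U = C1coKq x.toKIdx (trBasis N) (bg9YR (Matrix (Fin N) (Fin N) ℂ) (specialUnitaryUnits (Fin N)) R₁ R₂ x) (fun U => U)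
        (𝔮 x.toKIdx) (𝔮s x.toKIdx) (parS x.toKIdx) (GpPhysY x.toKIdx (parS x.toKIdx)) (𝔯 x).Δ2 U) ∧
    (∀ (x : MemberY θ.d₆ θ.ℓ₆ θ.hd' θ.hL' θ.b₀ θ.b₁ Mstar) (U : (bg9YR (Matrix (Fin N) (Fin N) ℂ) (specialUnitaryUnits (Fin N)) R₁ R₂ x).Cfg),
      (𝔬12 x).Dv U = DvcoKH x.toKIdx (trBasis N) (bg9YR (Matrix (Fin N) (Fin N) ℂ) (specialUnitaryUnits (Fin N)) R₁ R₂ x) (fun U => U) U) ∧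
    (∀ (x : MemberY θ.d₆ θ.ℓ₆ θ.hd' θ.hL' θ.b₀ θ.b₁ Mstar) (U : (bg9YR (Matrix (Fin N) (Fin N) ℂ) (specialUnitaryUnits (Fin N)) R₁ R₂ x).Cfg),
      (𝔬12 x).Dvstar U = DvscoKH x.toKIdx (trBasis N) (bg9YR (Matrix (Fin N) (Fin N) ℂ) (specialUnitaryUnits (Fin N)) R₁ R₂ x) (fun U => U) U) ∧
    (∀ (x : MemberY θ.d₆ θ.ℓ₆ θ.hd' θ.hL' θ.b₀ θ.b₁ Mstar) (U : (bg9YR (Matrix (Fin N) (Fin N) ℂ) (specialUnitaryUnits (Fin N)) R₁ R₂ x).Cfg),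
      (𝔬12 x).R U = RcoK x.toKIdx (trBasis N) (bg9YR (Matrix (Fin N) (Fin N) ℂ) (specialUnitaryUnits (Fin N)) R₁ R₂ x) (fun U => U)
        (parS x.toKIdx) (GpPhysY x.toKIdx (parS x.toKIdx)) U) := by
  subst h𝔬12
  exact ⟨ops312YOfRecordPar_blk N θ Mstar 𝔯 R₁ R₂ bI 𝔏 𝔮 𝔮s parS, ops312YOfRecordPar_blkW N θ Mstar 𝔯 R₁ R₂ bI 𝔏 𝔮 𝔮s parS, ops312YOfRecordPar_blkY N θ Mstar 𝔯 R₁ R₂ bI 𝔏 𝔮 𝔮s parS,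
    ops312YOfRecordPar_G0 N θ Mstar 𝔯 R₁ R₂ bI 𝔏 𝔮 𝔮s parS, ops312YOfRecordPar_G N θ Mstar 𝔯 R₁ R₂ bI 𝔏 𝔮 𝔮s parS, ops312YOfRecordPar_G1 N θ Mstar 𝔯 R₁ R₂ bI 𝔏 𝔮 𝔮s parS,
    ops312YOfRecordPar_GG N θ Mstar 𝔯 R₁ R₂ bI 𝔏 𝔮 𝔮s parS, ops312YOfRecordPar_D N θ Mstar 𝔯 R₁ R₂ bI 𝔏 𝔮 𝔮s parS, ops312YOfRecordPar_Dstar N θ Mstar 𝔯 R₁ R₂ bI 𝔏 𝔮 𝔮s parS,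
    ops312YOfRecordPar_blkZ N θ Mstar 𝔯 R₁ R₂ bI 𝔏 𝔮 𝔮s parS, ops312YOfRecordPar_Hm N θ Mstar 𝔯 R₁ R₂ bI 𝔏 𝔮 𝔮s parS, ops312YOfRecordPar_H1m N θ Mstar 𝔯 R₁ R₂ bI 𝔏 𝔮 𝔮s parS,
    ops312YOfRecordPar_S0 N θ Mstar 𝔯 R₁ R₂ bI 𝔏 𝔮 𝔮s parS, ops312YOfRecordPar_Tpi N θ Mstar 𝔯 R₁ R₂ bI 𝔏 𝔮 𝔮s parS, ops312YOfRecordPar_T2 N θ Mstar 𝔯 R₁ R₂ bI 𝔏 𝔮 𝔮s parS,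
    ops312YOfRecordPar_Q N θ Mstar 𝔯 R₁ R₂ bI 𝔏 𝔮 𝔮s parS, ops312YOfRecordPar_Qstar N θ Mstar 𝔯 R₁ R₂ bI 𝔏 𝔮 𝔮s parS, ops312YOfRecordPar_C N θ Mstar 𝔯 R₁ R₂ bI 𝔏 𝔮 𝔮s parS,
    ops312YOfRecordPar_C1 N θ Mstar 𝔯 R₁ R₂ bI 𝔏 𝔮 𝔮s parS, ops312YOfRecordPar_Dv N θ Mstar 𝔯 R₁ R₂ bI 𝔏 𝔮 𝔮s parS, ops312YOfRecordPar_Dvstar N θ Mstar 𝔯 R₁ R₂ bI 𝔏 𝔮 𝔮s parS,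
    ops312YOfRecordPar_R N θ Mstar 𝔯 R₁ R₂ bI 𝔏 𝔮 𝔮s parS⟩

end Pins

section PinsK

variable {N : ℕ} [Nonempty (Fin N)] {θ : Stage3Params} {Mstar : ℕ} {𝔯 : ResY N θ Mstar}
  {R₁ R₂ : RegFamY θ.d₆ θ.ℓ₆ θ.hd' θ.hL' θ.b₀ θ.b₁ Mstar (Matrix (Fin N) (Fin N) ℂ)}
  {bI : ∀ x : MemberY θ.d₆ θ.ℓ₆ θ.hd' θ.hL' θ.b₀ θ.b₁ Mstar, FBondY x.toKIdx → IBondY x.toKIdx}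

/-- ★★★ **THE TWENTY-TWO PINS OF THE KNIT CERTIFICATE FROM ONE EQUATION**: if `𝔬12 = ops312YOfRecordK N θ M⋆ 𝔯 R₁ R₂ bI`, the twenty-two displayed
hypotheses `hblk12 … hRco12` hold in the shapes and ORDER of `Node00.OpsYOps312OfRecord.pins312_of_eq`, with the letters of record read as
`lettersYOfRecordV11K N θ M⋆ 𝔯 x`, the averaging pair as `(qKnitOfRecord N θ x.toKIdx, qsKnitOfRecord N θ x.toKIdx)` (through `S0coKq ∕ QcoKHq ∕ QscoKHq ∕ CcoKq ∕
C1coKq`) and the site transporter as `parKnitY x.toKIdx` (site operator `GpPhysY x.toKIdx (parKnitY x.toKIdx)`).  Usage: `obtain ⟨hblk12, …, hRco12⟩ :=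
OpsYOps312OfRecordPar.pins312K_of_eq h𝔬12`.
[cite: Balaban1985BackgroundPropagators, Thm 3.12 p.423, Thm 3.13 p.426, (3.120)–(3.153) pp.419–426, (3.115) p.418, bookkeeping] [cite: Balaban1985Averaging, Prop. 2 p.26] -/
theorem pins312K_of_eq
    {𝔬12 : ∀ x : MemberY θ.d₆ θ.ℓ₆ θ.hd' θ.hL' θ.b₀ θ.b₁ Mstar, B9Thm312Whole.Ops (geo9Y x)
      (bg9YR (Matrix (Fin N) (Fin N) ℂ) (specialUnitaryUnits (Fin N)) R₁ R₂ x) (XBK (TrIdx N) x.toKIdx) (XBK (TrIdx N) x.toKIdx)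
      (XHK (TrIdx N) x.toKIdx) (XSK (TrIdx N) x.toKIdx)}
    (h𝔬12 : 𝔬12 = ops312YOfRecordK N θ Mstar 𝔯 R₁ R₂ bI) :
    (∀ x : MemberY θ.d₆ θ.ℓ₆ θ.hd' θ.hL' θ.b₀ θ.b₁ Mstar, (𝔬12 x).blk = blkBK x.toKIdx (bI x)) ∧
    (∀ x : MemberY θ.d₆ θ.ℓ₆ θ.hd' θ.hL' θ.b₀ θ.b₁ Mstar, (𝔬12 x).blkW = blkSK x.toKIdx (sIK x.toKIdx (bI x))) ∧
    (∀ x : MemberY θ.d₆ θ.ℓ₆ θ.hd' θ.hL' θ.b₀ θ.b₁ Mstar, (𝔬12 x).blkY = blkBK x.toKIdx (bI x)) ∧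
    (∀ (x : MemberY θ.d₆ θ.ℓ₆ θ.hd' θ.hL' θ.b₀ θ.b₁ Mstar) (U : (bg9YR (Matrix (Fin N) (Fin N) ℂ) (specialUnitaryUnits (Fin N)) R₁ R₂ x).Cfg),
      (𝔬12 x).G0 U = GcoK x.toKIdx (trBasis N) (bg9YR (Matrix (Fin N) (Fin N) ℂ) (specialUnitaryUnits (Fin N)) R₁ R₂ x) (fun U => U)
        (lettersYOfRecordV11K N θ Mstar 𝔯 x).GA U) ∧
    (∀ (x : MemberY θ.d₆ θ.ℓ₆ θ.hd' θ.hL' θ.b₀ θ.b₁ Mstar) (U : (bg9YR (Matrix (Fin N) (Fin N) ℂ) (specialUnitaryUnits (Fin N)) R₁ R₂ x).Cfg),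
      (𝔬12 x).G U = GcoK x.toKIdx (trBasis N) (bg9YR (Matrix (Fin N) (Fin N) ℂ) (specialUnitaryUnits (Fin N)) R₁ R₂ x) (fun U => U)
        (lettersYOfRecordV11K N θ Mstar 𝔯 x).GD U) ∧
    (∀ (x : MemberY θ.d₆ θ.ℓ₆ θ.hd' θ.hL' θ.b₀ θ.b₁ Mstar) (U : (bg9YR (Matrix (Fin N) (Fin N) ℂ) (specialUnitaryUnits (Fin N)) R₁ R₂ x).Cfg),
      (𝔬12 x).G1 U = GcoK x.toKIdx (trBasis N) (bg9YR (Matrix (Fin N) (Fin N) ℂ) (specialUnitaryUnits (Fin N)) R₁ R₂ x) (fun U => U)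
        (lettersYOfRecordV11K N θ Mstar 𝔯 x).G₁ U) ∧
    (∀ (x : MemberY θ.d₆ θ.ℓ₆ θ.hd' θ.hL' θ.b₀ θ.b₁ Mstar) (U : (bg9YR (Matrix (Fin N) (Fin N) ℂ) (specialUnitaryUnits (Fin N)) R₁ R₂ x).Cfg),
      (𝔬12 x).GG U = GcoK x.toKIdx (trBasis N) (bg9YR (Matrix (Fin N) (Fin N) ℂ) (specialUnitaryUnits (Fin N)) R₁ R₂ x) (fun U => U)
        (lettersYOfRecordV11K N θ Mstar 𝔯 x).GG U) ∧
    (∀ (x : MemberY θ.d₆ θ.ℓ₆ θ.hd' θ.hL' θ.b₀ θ.b₁ Mstar) (U : (bg9YR (Matrix (Fin N) (Fin N) ℂ) (specialUnitaryUnits (Fin N)) R₁ R₂ x).Cfg),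
      (𝔬12 x).D U = DcoK x.toKIdx (trBasis N) (bg9YR (Matrix (Fin N) (Fin N) ℂ) (specialUnitaryUnits (Fin N)) R₁ R₂ x) (fun U => U) U) ∧
    (∀ (x : MemberY θ.d₆ θ.ℓ₆ θ.hd' θ.hL' θ.b₀ θ.b₁ Mstar) (U : (bg9YR (Matrix (Fin N) (Fin N) ℂ) (specialUnitaryUnits (Fin N)) R₁ R₂ x).Cfg),
      (𝔬12 x).Dstar U = DscoK x.toKIdx (trBasis N) (bg9YR (Matrix (Fin N) (Fin N) ℂ) (specialUnitaryUnits (Fin N)) R₁ R₂ x) (fun U => U) U) ∧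
    (∀ x : MemberY θ.d₆ θ.ℓ₆ θ.hd' θ.hL' θ.b₀ θ.b₁ Mstar, (𝔬12 x).blkZ = blkHK x.toKIdx) ∧
    (∀ (x : MemberY θ.d₆ θ.ℓ₆ θ.hd' θ.hL' θ.b₀ θ.b₁ Mstar) (U : (bg9YR (Matrix (Fin N) (Fin N) ℂ) (specialUnitaryUnits (Fin N)) R₁ R₂ x).Cfg),
      (𝔬12 x).Hm U = HcoK x.toKIdx (trBasis N) (bg9YR (Matrix (Fin N) (Fin N) ℂ) (specialUnitaryUnits (Fin N)) R₁ R₂ x) (fun U => U)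
        (lettersYOfRecordV11K N θ Mstar 𝔯 x).H U) ∧
    (∀ (x : MemberY θ.d₆ θ.ℓ₆ θ.hd' θ.hL' θ.b₀ θ.b₁ Mstar) (U : (bg9YR (Matrix (Fin N) (Fin N) ℂ) (specialUnitaryUnits (Fin N)) R₁ R₂ x).Cfg),
      (𝔬12 x).H1m U = HcoK x.toKIdx (trBasis N) (bg9YR (Matrix (Fin N) (Fin N) ℂ) (specialUnitaryUnits (Fin N)) R₁ R₂ x) (fun U => U)
        (lettersYOfRecordV11K N θ Mstar 𝔯 x).H₁ U) ∧
    (∀ (x : MemberY θ.d₆ θ.ℓ₆ θ.hd' θ.hL' θ.b₀ θ.b₁ Mstar) (U : (bg9YR (Matrix (Fin N) (Fin N) ℂ) (specialUnitaryUnits (Fin N)) R₁ R₂ x).Cfg),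
      (𝔬12 x).S0 U = S0coKq x.toKIdx (trBasis N) (bg9YR (Matrix (Fin N) (Fin N) ℂ) (specialUnitaryUnits (Fin N)) R₁ R₂ x) (fun U => U)
        (qKnitOfRecord N θ x.toKIdx) (qsKnitOfRecord N θ x.toKIdx) (parKnitY x.toKIdx) (GpPhysY x.toKIdx (parKnitY x.toKIdx)) U) ∧
    (∀ (x : MemberY θ.d₆ θ.ℓ₆ θ.hd' θ.hL' θ.b₀ θ.b₁ Mstar) (U : (bg9YR (Matrix (Fin N) (Fin N) ℂ) (specialUnitaryUnits (Fin N)) R₁ R₂ x).Cfg),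
      (𝔬12 x).Tpi U = TpicoK x.toKIdx (trBasis N) (bg9YR (Matrix (Fin N) (Fin N) ℂ) (specialUnitaryUnits (Fin N)) R₁ R₂ x) (fun U => U)
        (parKnitY x.toKIdx) (GpPhysY x.toKIdx (parKnitY x.toKIdx)) U) ∧
    (∀ (x : MemberY θ.d₆ θ.ℓ₆ θ.hd' θ.hL' θ.b₀ θ.b₁ Mstar) (U : (bg9YR (Matrix (Fin N) (Fin N) ℂ) (specialUnitaryUnits (Fin N)) R₁ R₂ x).Cfg),
      (𝔬12 x).T2 U = T2coK x.toKIdx (trBasis N) (bg9YR (Matrix (Fin N) (Fin N) ℂ) (specialUnitaryUnits (Fin N)) R₁ R₂ x) (fun U => U)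
        (parKnitY x.toKIdx) (GpPhysY x.toKIdx (parKnitY x.toKIdx)) (𝔯 x).Δ2 U) ∧
    (∀ (x : MemberY θ.d₆ θ.ℓ₆ θ.hd' θ.hL' θ.b₀ θ.b₁ Mstar) (U : (bg9YR (Matrix (Fin N) (Fin N) ℂ) (specialUnitaryUnits (Fin N)) R₁ R₂ x).Cfg),
      (𝔬12 x).Q U = QcoKHq x.toKIdx (trBasis N) (bg9YR (Matrix (Fin N) (Fin N) ℂ) (specialUnitaryUnits (Fin N)) R₁ R₂ x) (fun U => U)
        (qKnitOfRecord N θ x.toKIdx) U) ∧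
    (∀ (x : MemberY θ.d₆ θ.ℓ₆ θ.hd' θ.hL' θ.b₀ θ.b₁ Mstar) (U : (bg9YR (Matrix (Fin N) (Fin N) ℂ) (specialUnitaryUnits (Fin N)) R₁ R₂ x).Cfg),
      (𝔬12 x).Qstar U = QscoKHq x.toKIdx (trBasis N) (bg9YR (Matrix (Fin N) (Fin N) ℂ) (specialUnitaryUnits (Fin N)) R₁ R₂ x) (fun U => U)
        (qsKnitOfRecord N θ x.toKIdx) U) ∧
    (∀ (x : MemberY θ.d₆ θ.ℓ₆ θ.hd' θ.hL' θ.b₀ θ.b₁ Mstar) (U : (bg9YR (Matrix (Fin N) (Fin N) ℂ) (specialUnitaryUnits (Fin N)) R₁ R₂ x).Cfg),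
      (𝔬12 x).C U = CcoKq x.toKIdx (trBasis N) (bg9YR (Matrix (Fin N) (Fin N) ℂ) (specialUnitaryUnits (Fin N)) R₁ R₂ x) (fun U => U)
        (qKnitOfRecord N θ x.toKIdx) (qsKnitOfRecord N θ x.toKIdx) (parKnitY x.toKIdx) (GpPhysY x.toKIdx (parKnitY x.toKIdx)) U) ∧
    (∀ (x : MemberY θ.d₆ θ.ℓ₆ θ.hd' θ.hL' θ.b₀ θ.b₁ Mstar) (U : (bg9YR (Matrix (Fin N) (Fin N) ℂ) (specialUnitaryUnits (Fin N)) R₁ R₂ x).Cfg),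
      (𝔬12 x).C1 U = C1coKq x.toKIdx (trBasis N) (bg9YR (Matrix (Fin N) (Fin N) ℂ) (specialUnitaryUnits (Fin N)) R₁ R₂ x) (fun U => U)
        (qKnitOfRecord N θ x.toKIdx) (qsKnitOfRecord N θ x.toKIdx) (parKnitY x.toKIdx) (GpPhysY x.toKIdx (parKnitY x.toKIdx)) (𝔯 x).Δ2 U) ∧
    (∀ (x : MemberY θ.d₆ θ.ℓ₆ θ.hd' θ.hL' θ.b₀ θ.b₁ Mstar) (U : (bg9YR (Matrix (Fin N) (Fin N) ℂ) (specialUnitaryUnits (Fin N)) R₁ R₂ x).Cfg),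
      (𝔬12 x).Dv U = DvcoKH x.toKIdx (trBasis N) (bg9YR (Matrix (Fin N) (Fin N) ℂ) (specialUnitaryUnits (Fin N)) R₁ R₂ x) (fun U => U) U) ∧
    (∀ (x : MemberY θ.d₆ θ.ℓ₆ θ.hd' θ.hL' θ.b₀ θ.b₁ Mstar) (U : (bg9YR (Matrix (Fin N) (Fin N) ℂ) (specialUnitaryUnits (Fin N)) R₁ R₂ x).Cfg),
      (𝔬12 x).Dvstar U = DvscoKH x.toKIdx (trBasis N) (bg9YR (Matrix (Fin N) (Fin N) ℂ) (specialUnitaryUnits (Fin N)) R₁ R₂ x) (fun U => U) U) ∧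
    (∀ (x : MemberY θ.d₆ θ.ℓ₆ θ.hd' θ.hL' θ.b₀ θ.b₁ Mstar) (U : (bg9YR (Matrix (Fin N) (Fin N) ℂ) (specialUnitaryUnits (Fin N)) R₁ R₂ x).Cfg),
      (𝔬12 x).R U = RcoK x.toKIdx (trBasis N) (bg9YR (Matrix (Fin N) (Fin N) ℂ) (specialUnitaryUnits (Fin N)) R₁ R₂ x) (fun U => U)
        (parKnitY x.toKIdx) (GpPhysY x.toKIdx (parKnitY x.toKIdx)) U) :=
  pins312Par_of_eq (h𝔬12.trans (ops312YOfRecordK_eq N θ Mstar 𝔯 R₁ R₂ bI))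

end PinsK

end Literature.MathematicalPhysics.QuantumFieldTheory.Balaban1983to89.Node00.OpsYOps312OfRecordPar
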